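import Summits.Ventures.Crystal3D.Bulk.GapVertexSectors
import Summits.Ventures.Crystal3D.Bulk.GapTwoConnected
import HarnessLib

/-!
# P-L3(g) for the GAP census: the tight graph of a census configuration is 3-CONNECTED
# (no separating pair), regions-free — consequence of LEMMA L via `Bulk/GapVertexSectors.lean`

HONEST FRAMING. Part of the venture `Summits/Ventures/Crystal3D` (cell `pub-crystal3d`, phase 2;
seat typer-bulk-2). Kernel theorem about every configuration satisfying `CensusRows c`; nothing is
claimed about GAP(1.26). Row P-L3(g) of the cell's `DESIGN-L12-THEORY.md` v0.6 («`T′` is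
3-connected») is the premise under which the census may be generated in plantri's 3-connected
class `-p -c3 -m3 -f6` (the exactly-2-connected plane maps need no computation). It was «paper ×2»
(theory-1 + ref-2 S6); here it is a tree theorem, proved WITHOUT faces as point sets:

Let `u ≠ v` be active vertices and `A | B` a splitting of `activeVertices c ∖ {u, v}` into two
nonempty classes closed under tight adjacency avoiding `u, v`.
* `CensusRows.exists_touch`: each class has a vertex adjacent to `u` and one adjacent to `v`
  (a class not adjacent to `u` is closed avoiding `v` alone — against `tightTwoConnected`,
  `Bulk/GapTwoConnected.lean`);
* `CensusRows.exists_oface_vertex_eq` (the walk lemma, as in `Bulk/GapTwoConnected.lean`): for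
  rotation-consecutive partners `p ∈ A`, `onextNbr c v p ∈ B` of `v`, the face of the dart
  `(p, v)` runs `p, v, onextNbr c v p, …` and can only return to `p ∈ A` through `u`, at a walk
  index `≥ 3`;
* `CensusRows.not_bothTouch`: if `u` is a tight partner of `v`, choose the consecutive pair on the
  way round from `onextNbr c v u` (it avoids `u`), and `u` on that face contradicts
  `CensusRows.not_mem_tightNbrs_of_oface`; if not, the `A → B` and the `B → A` transitions give two
  distinct faces at `v` through `u`, contradicting `CensusRows.oface_vertex_ne_of_ne`.
* **`CensusRows.tightThreeConnected`** — for all active `u ≠ v`, every nonempty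
  `A ⊆ activeVertices c ∖ {u, v}` closed under tight adjacency avoiding `u` and `v` is ALL of
  `activeVertices c ∖ {u, v}`: the tight graph minus any two vertices is still connected.
-/

noncomputable section

namespace Summit.Ventures.Crystal3D

open Literature.Geometry.DiscreteGeometry Finset Function

variable {c : Fin 14 → EuclideanSpace ℝ (Fin 3)}

/-! ## Two combinatorial lemmas on iteration -/

/-- Iterating out of a set: if `a ∈ A` and `f^[k] a ∉ A`, some earlier iterate is in `A` with its
successor outside. -/
theorem exists_step_out {α : Type*} (f : α → α) (A : Finset α) {a : α} (haA : a ∈ A) {k : ℕ}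
    (hk : f^[k] a ∉ A) : ∃ k0 < k, f^[k0] a ∈ A ∧ f^[k0 + 1] a ∉ A := by
  induction k with
  | zero => exact absurd haA hk
  | succ k ih =>
    by_cases hkA : f^[k] a ∈ A
    · exact ⟨k, Nat.lt_succ_self k, hkA, hk⟩
    · obtain ⟨k0, hk0, h1, h2⟩ := ih hkA
      exact ⟨k0, by omega, h1, h2⟩

/-- First arrival avoids the start: if `k` is the least exponent with `f^[k] (f u) = b` and
`b ≠ u`, then no `f^[j] (f u)`, `j ≤ k`, equals `u`. -/
theorem iterate_ne_of_first_arrival {α : Type*} (f : α → α) {u b : α} {k : ℕ}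
    (hk : f^[k] (f u) = b) (hmin : ∀ j < k, f^[j] (f u) ≠ b) (hbu : b ≠ u) {j : ℕ} (hj : j ≤ k) :
    f^[j] (f u) ≠ u := by
  intro hju
  rcases hj.lt_or_eq with hlt | rfl
  · have hj1 : f^[j + 1] (f u) = f u := by rw [iterate_succ_apply', hju]
    have e : k = (k - (j + 1)) + (j + 1) := by omega
    rw [e, iterate_add_apply, hj1] at hk
    exact hmin _ (by omega) hk
  · exact hbu (hk.symm.trans hju)

/-! ## The walk lemma -/

/-- **The walk lemma.** Let `p ∈ A` be a tight partner of `v` with `onextNbr c v p ∈ B`, where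
`A` misses `B` and `B` is closed under tight adjacency avoiding `u` and `v`, and `p ≠ u`. Then the
face of the dart `(p, v)` passes through `u` at a walk index `n` with `3 ≤ n < ofaceLen c (p, v)`:
its walk `p, v, onextNbr c v p, …` never revisits `v` (distinct vertices), so from index `2` on it
stays in `B` unless it meets `u` — and it ends at `p ∈ A`. -/
theorem CensusRows.exists_oface_vertex_eq (h : CensusRows c) {u v p : Fin 14} (hv0 : v ≠ 0)
    (hp : p ∈ tightNbrs c v) (hpu : p ≠ u) {A B : Finset (Fin 14)} (hpA : p ∈ A)
    (hp'B : onextNbr c v p ∈ B) (hAB : ∀ i ∈ A, i ∉ B)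
    (hBcl : ∀ i ∈ B, ∀ j : Fin 14, (i, j) ∈ darts c → j ≠ u → j ≠ v → j ∈ B) :
    ∃ n, 3 ≤ n ∧ n < ofaceLen c (p, v) ∧ ((ofaceSucc c)^[n] (p, v)).1 = u := by
  by_contra hno
  push Not at hno
  set q : Fin 14 × Fin 14 := (p, v) with hqdef
  have hq : q ∈ darts c := swap_mem_darts (mk_mem_darts hv0 hp)
  set t : ℕ → Fin 14 := fun n => ((ofaceSucc c)^[n] q).1 with ht
  have ht1 : t 1 = v := rfl
  have ht2 : t 2 = onextNbr c v p := by
    rw [ht]; simp only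
    rw [show (2 : ℕ) = 1 + 1 from rfl, iterate_succ_apply', iterate_one]
    rfl
  set m := ofaceLen c q with hm
  have hm3 : 3 ≤ m := h.three_le_ofaceLen hq
  have htm : t m = p := by
    rw [ht]; simp only; rw [hm, iterate_ofaceLen]
  have hstep : ∀ n, (t n, t (n + 1)) ∈ darts c := by
    intro n
    have := h.isGapConfig.iterate_ofaceSucc_mem_darts h.intruderDist_bounds.1 hq n
    rw [ht]; simp only
    rw [iterate_succ_apply']
    exact this
  have hnov : ∀ n, 2 ≤ n → n < m → t n ≠ v := by
    intro n hn2 hnm heq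
    exact h.fst_iterate_ofaceSucc_injOn hq (show 1 < n by omega) hnm
      (by rw [← ht1] at heq; exact heq.symm)
  -- from index `2` on the walk stays in `B`
  have hstay : ∀ n, 2 ≤ n → n ≤ m → t n ∈ B := by
    intro n hn2
    induction n with
    | zero => intro _; omega
    | succ n ih =>
      intro hnm
      rcases Nat.lt_or_ge n 2 with hn | hn
      · have : n = 1 := by omega
        subst this
        rw [ht2]; exact hp'B
      · have hnB := ih hn (by omega)
        refine hBcl _ hnB _ (hstep n) ?_ ?_
        · rcases Nat.lt_or_ge (n + 1) m with hlt | hge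
          · exact hno (n + 1) (by omega) hlt
          · have : n + 1 = m := by omega
            rw [this, htm]; exact hpu
        · rcases Nat.lt_or_ge (n + 1) m with hlt | hge
          · exact hnov (n + 1) (by omega) hlt
          · have : n + 1 = m := by omega
            rw [this, htm]; exact (mem_tightNbrs.1 hp).2.1
  have hpB : p ∈ B := htm ▸ hstay m (by omega) le_rfl
  exact hAB p hpA hpB

/-! ## Both classes adjacent to `v`: impossible -/

/-- The case `u ∈ N(v)` with `onextNbr c v u ∈ A`: walking round `v` from `onextNbr c v u` to the
first partner outside `A` (reached no later than a given `b ∈ B`, hence before returning to `u`)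
gives consecutive partners `p ∈ A`, `onextNbr c v p ∈ B`, both `≠ u`; the face of `(p, v)`
passes through the tight partner `u` of `v` at index `≥ 3` — against
`CensusRows.not_mem_tightNbrs_of_oface`. -/
theorem CensusRows.not_bothTouch_of_onextNbr_mem (h : CensusRows c) {u v : Fin 14} (hv0 : v ≠ 0)
    (huN : u ∈ tightNbrs c v) {A B : Finset (Fin 14)} (huA : u ∉ A) (huB : u ∉ B)
    (hAB : ∀ i ∈ A, i ∉ B) (hcov : ∀ j ∈ tightNbrs c v, j ≠ u → j ∈ A ∨ j ∈ B)
    (hBcl : ∀ i ∈ B, ∀ j : Fin 14, (i, j) ∈ darts c → j ≠ u → j ≠ v → j ∈ B)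
    (hp1A : onextNbr c v u ∈ A) {b : Fin 14} (hb : b ∈ tightNbrs c v) (hbB : b ∈ B) : False := by
  classical
  set f := onextNbr c v with hf
  have hp1 : f u ∈ tightNbrs c v := (h.onextNbr_mem_ne hv0 huN).1
  -- first arrival at `b` from `f u`
  have hex : ∃ k, f^[k] (f u) = b := h.exists_iterate_onextNbr_eq hv0 hp1 hb
  have hkb : f^[Nat.find hex] (f u) = b := Nat.find_spec hex
  have hmin : ∀ j < Nat.find hex, f^[j] (f u) ≠ b := fun j hj => Nat.find_min hex hj
  have hbA : b ∉ A := fun hbA' => hAB b hbA' hbB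
  have hbu : b ≠ u := fun he => huB (he ▸ hbB)
  obtain ⟨k0, hk0, hpA, hp'A⟩ := exists_step_out f A hp1A (k := Nat.find hex)
    (by rw [hkb]; exact hbA)
  set p := f^[k0] (f u) with hpdef
  have hpN : p ∈ tightNbrs c v := h.iterate_onextNbr_mem hv0 hp1 k0
  have hp' : f^[k0 + 1] (f u) = onextNbr c v p := by rw [iterate_succ_apply']
  have hp'N : onextNbr c v p ∈ tightNbrs c v := (h.onextNbr_mem_ne hv0 hpN).1
  have hp'u : onextNbr c v p ≠ u := by
    rw [← hp']
    exact iterate_ne_of_first_arrival f hkb hmin hbu (by omega)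
  have hpu : p ≠ u := fun he => huA (he ▸ hpA)
  have hp'B : onextNbr c v p ∈ B := by
    rcases hcov _ hp'N hp'u with hA | hB
    · exact absurd hA (hp' ▸ hp'A)
    · exact hB
  obtain ⟨n, h3, hn, hnu⟩ := h.exists_oface_vertex_eq hv0 hpN hpu hpA hp'B hAB hBcl
  have hq : (p, v) ∈ darts c := swap_mem_darts (mk_mem_darts hv0 hpN)
  have := h.not_mem_tightNbrs_of_oface hq h3 hn
  rw [hnu] at this
  exact this huN

/-- **Two classes split by `{u, v}` cannot both be adjacent to `v`.** Let `A`, `B` be disjoint,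
closed under tight adjacency avoiding `u, v`, missing `u`, and together containing every tight
partner of `v` other than `u`; if `A` and `B` both contain a tight partner of `v`, contradiction:
round `v` there are rotation-consecutive partners of different classes avoiding `u`, the face
through them passes through `u` at index `≥ 3` (walk lemma), which LOCAL STEP 1
(`Bulk/GapVertexSectors.lean`) forbids — once if `u` is a partner of `v`, for the two opposite
transitions otherwise. -/
theorem CensusRows.not_bothTouch (h : CensusRows c) {u v : Fin 14} (hv0 : v ≠ 0)
    {A B : Finset (Fin 14)} (huA : u ∉ A) (huB : u ∉ B) (hAB : ∀ i ∈ A, i ∉ B)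
    (hcov : ∀ j ∈ tightNbrs c v, j ≠ u → j ∈ A ∨ j ∈ B)
    (hAcl : ∀ i ∈ A, ∀ j : Fin 14, (i, j) ∈ darts c → j ≠ u → j ≠ v → j ∈ A)
    (hBcl : ∀ i ∈ B, ∀ j : Fin 14, (i, j) ∈ darts c → j ≠ u → j ≠ v → j ∈ B)
    {a b : Fin 14} (ha : a ∈ tightNbrs c v) (haA : a ∈ A) (hb : b ∈ tightNbrs c v)
    (hbB : b ∈ B) : False := by
  classical
  have hBA : ∀ i ∈ B, i ∉ A := fun i hiB hiA => hAB i hiA hiB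
  have hcov' : ∀ j ∈ tightNbrs c v, j ≠ u → j ∈ B ∨ j ∈ A :=
    fun j hj hju => (hcov j hj hju).symm
  by_cases huN : u ∈ tightNbrs c v
  · -- `u` is a partner of `v`: start the round trip at `onextNbr c v u`
    obtain ⟨hp1, hp1u⟩ := h.onextNbr_mem_ne hv0 huN
    rcases hcov _ hp1 hp1u with hA | hB
    · exact h.not_bothTouch_of_onextNbr_mem hv0 huN huA huB hAB hcov hBcl hA hb hbB
    · exact h.not_bothTouch_of_onextNbr_mem hv0 huN huB huA hBA hcov' hAcl hB ha haA
  · -- `u` is not a partner of `v`: an `A → B` and a `B → A` transition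
    set f := onextNbr c v with hf
    have trans : ∀ {A B : Finset (Fin 14)} {a b : Fin 14}, (∀ i ∈ A, i ∉ B) →
        (∀ j ∈ tightNbrs c v, j ≠ u → j ∈ A ∨ j ∈ B) →
        (∀ i ∈ B, ∀ j : Fin 14, (i, j) ∈ darts c → j ≠ u → j ≠ v → j ∈ B) →
        a ∈ tightNbrs c v → a ∈ A → b ∈ tightNbrs c v → b ∈ B →
        ∃ p ∈ tightNbrs c v, p ∈ A ∧ ∃ n, 3 ≤ n ∧ n < ofaceLen c (p, v) ∧
          ((ofaceSucc c)^[n] (p, v)).1 = u := by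
      intro A B a b hAB hcov hBcl ha haA hb hbB
      obtain ⟨k, hk⟩ := h.exists_iterate_onextNbr_eq hv0 ha hb
      obtain ⟨k0, -, hpA, hp'A⟩ := exists_step_out f A haA (k := k)
        (by rw [hk]; exact fun hbA => hAB b hbA hbB)
      set p := f^[k0] a with hpdef
      have hpN : p ∈ tightNbrs c v := h.iterate_onextNbr_mem hv0 ha k0
      have hp' : f^[k0 + 1] a = onextNbr c v p := by rw [iterate_succ_apply']
      have hp'N : onextNbr c v p ∈ tightNbrs c v := (h.onextNbr_mem_ne hv0 hpN).1
      have hp'u : onextNbr c v p ≠ u := fun he => huN (he ▸ hp'N)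
      have hpu : p ≠ u := fun he => huN (he ▸ hpN)
      have hp'B : onextNbr c v p ∈ B := by
        rcases hcov _ hp'N hp'u with hA | hB
        · exact absurd hA (hp' ▸ hp'A)
        · exact hB
      exact ⟨p, hpN, hpA, h.exists_oface_vertex_eq hv0 hpN hpu hpA hp'B hAB hBcl⟩
    obtain ⟨p, hpN, hpA, n, h3, hn, hnu⟩ := trans hAB hcov hBcl ha haA hb hbB
    obtain ⟨p', hp'N, hp'B, n', h3', hn', hn'u⟩ := trans hBA hcov' hAcl hb hbB ha haA
    have hpp' : p ≠ p' := fun he => hAB p hpA (he ▸ hp'B)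
    have hq : (p, v) ∈ darts c := swap_mem_darts (mk_mem_darts hv0 hpN)
    have hq' : (p', v) ∈ darts c := swap_mem_darts (mk_mem_darts hv0 hp'N)
    exact h.oface_vertex_ne_of_ne hq hq' rfl hpp' h3 hn h3' hn' (hnu.trans hn'u.symm)

/-! ## Reduction: each class touches both `u` and `v` -/

/-- **Each class is adjacent to `u`** (and, symmetrically, to `v`). A nonempty class `C` of
active vertices missing `u, v` and closed under tight adjacency avoiding `u` and `v` has a vertex
adjacent to `u`: otherwise `C` is closed under tight adjacency avoiding `v` alone, so by
`tightTwoConnected` it is all of `activeVertices c ∖ {v} ∋ u`. -/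
theorem CensusRows.exists_touch (h : CensusRows c) {u v : Fin 14} (hu : u ∈ activeVertices c)
    (hv : v ∈ activeVertices c) (huv : u ≠ v) {C : Finset (Fin 14)} (hC : C ⊆ activeVertices c)
    (huC : u ∉ C) (hvC : v ∉ C) (hCne : C.Nonempty)
    (hCcl : ∀ i ∈ C, ∀ j : Fin 14, (i, j) ∈ darts c → j ≠ u → j ≠ v → j ∈ C) :
    ∃ x ∈ C, (x, u) ∈ darts c := by
  by_contra hno
  push Not at hno
  have hC' : C ⊆ (activeVertices c).erase v :=
    fun x hx => mem_erase.2 ⟨fun hxv => hvC (hxv ▸ hx), hC hx⟩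
  have hcl : ∀ i ∈ C, ∀ j : Fin 14, (i, j) ∈ darts c → j ≠ v → j ∈ C := by
    intro i hi j hij hjv
    by_cases hju : j = u
    · subst hju; exact absurd hij (hno i hi)
    · exact hCcl i hi j hij hju hjv
  have hall := h.tightTwoConnected hv hC' hCne hcl
  have : u ∈ C := by rw [hall]; exact mem_erase.2 ⟨huv, hu⟩
  exact huC this

/-! ## No separating pair -/

/-- **P-L3(g): the tight graph has no separating pair (3-connected).** For all active vertices
`u ≠ v`, every nonempty set `A` of active vertices other than `u, v` which contains, with a
vertex, every tight partner of it other than `u` and `v`, is ALL of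
`activeVertices c ∖ {u, v}`: the tight graph minus any two vertices is still connected. -/
theorem CensusRows.tightThreeConnected (h : CensusRows c) {u v : Fin 14}
    (hu : u ∈ activeVertices c) (hv : v ∈ activeVertices c) (huv : u ≠ v) {A : Finset (Fin 14)}
    (hA : A ⊆ ((activeVertices c).erase u).erase v) (hAne : A.Nonempty)
    (hAcl : ∀ i ∈ A, ∀ j : Fin 14, (i, j) ∈ darts c → j ≠ u → j ≠ v → j ∈ A) :
    A = ((activeVertices c).erase u).erase v := by
  classical
  obtain ⟨hv0, -⟩ := mem_activeVertices.1 hv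
  by_contra hne
  set V := ((activeVertices c).erase u).erase v with hV
  set B := V \ A with hBdef
  have hBne : B.Nonempty := by
    rw [hBdef, sdiff_nonempty]; exact fun hsub => hne (Subset.antisymm hA hsub)
  have hBsub : B ⊆ V := sdiff_subset
  have hVsub : V ⊆ activeVertices c := (erase_subset _ _).trans (erase_subset _ _)
  have hAB : ∀ i ∈ A, i ∉ B := fun i hiA hiB => (mem_sdiff.1 hiB).2 hiA
  -- membership of a dart head in `V`
  have memV : ∀ {i j : Fin 14}, (i, j) ∈ darts c → j ≠ u → j ≠ v → j ∈ V := by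
    intro i j hij hju hjv
    have hjN : j ∈ tightNbrs c i := snd_mem_tightNbrs_of_mem_darts hij
    exact mem_erase.2 ⟨hjv, mem_erase.2 ⟨hju,
      mem_activeVertices_of_mem_tightNbrs (mem_darts.1 hij).1 hjN⟩⟩
  have hBcl : ∀ i ∈ B, ∀ j : Fin 14, (i, j) ∈ darts c → j ≠ u → j ≠ v → j ∈ B := by
    intro i hi j hij hju hjv
    refine mem_sdiff.2 ⟨memV hij hju hjv, fun hjA => (mem_sdiff.1 hi).2 ?_⟩
    have hiV := hBsub hi
    exact hAcl j hjA i (swap_mem_darts hij) (mem_erase.1 (mem_erase.1 hiV).2).1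
      (mem_erase.1 hiV).1
  have huV : u ∉ V := fun h' => (mem_erase.1 (mem_erase.1 h').2).1 rfl
  have hvV : v ∉ V := fun h' => (mem_erase.1 h').1 rfl
  -- the partners of `v` other than `u` are coloured
  have hcov : ∀ j ∈ tightNbrs c v, j ≠ u → j ∈ A ∨ j ∈ B := by
    intro j hj hju
    have hjV : j ∈ V := memV (mk_mem_darts hv0 hj) hju (mem_tightNbrs.1 hj).2.1
    by_cases hjA : j ∈ A
    · exact Or.inl hjA
    · exact Or.inr (mem_sdiff.2 ⟨hjV, hjA⟩)
  -- both classes are adjacent to `v`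
  have nbr : ∀ {x w : Fin 14}, (x, w) ∈ darts c → x ∈ tightNbrs c w := by
    intro x w hxw
    have := snd_mem_tightNbrs_of_mem_darts (swap_mem_darts hxw)
    simpa only [Prod.fst_swap, Prod.snd_swap] using this
  obtain ⟨a, haA, hav⟩ := h.exists_touch hv hu huv.symm (hA.trans hVsub) (fun h' => hvV (hA h'))
    (fun h' => huV (hA h')) hAne (fun i hi j hij hjv hju => hAcl i hi j hij hju hjv)
  obtain ⟨b, hbB, hbv⟩ := h.exists_touch hv hu huv.symm (hBsub.trans hVsub)
    (fun h' => hvV (hBsub h')) (fun h' => huV (hBsub h')) hBne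
    (fun i hi j hij hjv hju => hBcl i hi j hij hju hjv)
  exact h.not_bothTouch hv0 (fun h' => huV (hA h')) (fun h' => huV (hBsub h')) hAB hcov hAcl hBcl
    (nbr hav) haA (nbr hbv) hbB

end Summit.Ventures.Crystal3D
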